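import Literature.AnabelianGeometry.SemiGraphs.LevelEdgesOfObject
import Literature.AnabelianGeometry.SemiGraphs.EdgePathTransport
import Literature.AnabelianGeometry.Anabelioids.FiberFunctorUnique
import Literature.AnabelianGeometry.Anabelioids.ExactFunctorProofs

/-!
# Level edges of `𝒢_X`: the loop transport and "loops all or none" ([SemiAnbd] §2, Def. 2.1 / 2.2 (i))

Mochizuki, *Semi-graphs of anabelioids*, Publ. RIMS **42** (2006), §2: p. 22, l. 12–13 ("this
profinite group is, in a natural sense, independent of the choice of basepoint, up to inner
automorphism"), Definition 2.1 p. 23 ("natural outer homomorphisms `Π_v → Π_𝒢`; `Π_b → Π_𝒢`" — so the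
two branches `b, b'` of one edge `e` give the same OUTER homomorphism `Π_e → Π_𝒢`) and Definition
2.2 (i) p. 23 (the covering `𝒢_X → 𝒢` attached to `X ∈ B(𝒢)`: vertices and edges of `𝔾_X` = connected
components of the `S_v`, `T_e`) [cite: MochizukiSemiAnbd2006, Def. 2.2(i) p.23].  (v2: doc-only —
the v1 module docstring paraphrased p. 23 as "well-defined up to composition with an inner
automorphism", which is not the printed wording; referee sweep note F27; declarations unchanged.)

Proof-only bookkeeping (cell abc-iut, layer L3, row F-1477 / [SemiAnbd] Rmk. 2.10.1, sub-node (L4)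
"level edges", part B, seat abc-iut-L6-t18; holder/assembler abc-iut-L3-t12), continuing
`LevelEdgesOfObject.lean`, for a LOOP `e = e(b) = e(b')` at `v` (both branches `b ≠ b'` abut to `v`):

* `exists_pi_loopTransport` — the LOOP ELEMENT `t ∈ Π_𝒢 = Aut(ρ_v ⋙ F)`: the natural automorphism
  `X ↦ α' ∘ F_e(ψ_{b'}⁻¹ ∘ ψ_b) ∘ α⁻¹` of the basepoint (edge-path transport of abc-iut-L3-t12's
  `EdgePathTransport.lean`, here with its POINT FORMULA, which is what pins components);
* `componentOver_eq_of_mem_transport` — the `b'`-END of the level edge of `𝒢_X` through `x` is the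
  level vertex through `t · x`;
* `vComp_eq_iff_mem_range_mul` — for an object all of whose points have stabiliser `V` (abc-iut-L3-t12's
  Galois object `A_V`): the level vertices through `x` and `t · x` coincide iff `t ∈ Π_v · V` — a
  condition INDEPENDENT of `x`, so the level edges over a loop `e` are ALL loops or NONE;
* `coveringGraph_hloop` — consequently the loop hypothesis `hloop` of abc-iut-L3-t12's
  `IsOfSurfaceType.exists_bObj_trivial_nontrivial` holds for any two level edges `(e, Q₁)`, `(e, Q₂)`
  of `𝒢_X = X.coveringGraph` over the same edge `e` (vacuously when `e` is not a loop of `𝔾`).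

No statement here takes a side on any disputed claim; nothing about [IUTchIII] Cor. 3.12.
-/

namespace Literature.AnabelianGeometry.SemiGraphs

open CategoryTheory CategoryTheory.PreGaloisCategory
open Literature.AnabelianGeometry.Anabelioids
open scoped Pointwise

universe v₁ u₁ u

namespace SemiGraphOfAnabelioids

variable {𝒢 : SemiGraphOfAnabelioids.{v₁, u₁, u}} (X : 𝒢.BObj) {v : 𝒢.graph.Vertex}
  (F : 𝒢.V v ⥤ FintypeCat.{v₁}) [FiberFunctor F] (b : 𝒢.graph.Branch) (h : 𝒢.graph.abuts b = some v)
  (Fe : 𝒢.E (𝒢.graph.edgeOf b) ⥤ FintypeCat.{v₁}) [FiberFunctor Fe]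
  (α : (𝒢.pull b v h).pullback ⋙ Fe ≅ F)

/-! ### Transport between equal edges (generic bookkeeping, by `subst`) -/

omit [FiberFunctor F] [FiberFunctor Fe] in
/-- Along `e₁ = e₂`: if a point `z ∈ F₂(T_{e₂})` lies in the fibre of a component `Q₂` of `T_{e₂}`, its
transport to `F₂(transportE (T_{e₁}))` lies in the fibre of the corresponding component `Q₁` of
`T_{e₁}`. [folklore] -/
private theorem mem_range_transport (Y : 𝒢.BObj) {e₁ e₂ : 𝒢.graph.Edge} (he : e₁ = e₂)
    (F₂ : 𝒢.E e₂ ⥤ FintypeCat.{v₁}) (Q₁ : π₀Obj (Y.T e₁)) (Q₂ : π₀Obj (Y.T e₂)) (hQ : HEq Q₁ Q₂)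
    (z : F₂.obj (Y.T e₂)) (hz : z ∈ Set.range (F₂.map Q₂.1.arrow)) :
    F₂.map (eqToHom (𝒢.transportE_obj_T Y he).symm) z ∈
      Set.range ((𝒢.transportE he ⋙ F₂).map Q₁.1.arrow) := by
  subst he
  cases hQ
  have hgen : ∀ (T : 𝒢.E e₁) (p : T = T) (w : F₂.obj T), F₂.map (eqToHom p) w = w := fun T p w => by
    rw [eqToHom_refl, F₂.map_id, FintypeCat.id_apply]
  have h0 : F₂.map (eqToHom (𝒢.transportE_obj_T Y rfl).symm) z = z := hgen _ _ z
  rw [h0]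
  exact hz

omit [FiberFunctor F] in
/-- `transportE he ⋙ F₂` is a fibre functor. [folklore] -/
private theorem fiberFunctor_transportE {e₁ e₂ : 𝒢.graph.Edge} (he : e₁ = e₂)
    (F₂ : 𝒢.E e₂ ⥤ FintypeCat.{v₁}) [hF : FiberFunctor F₂] : FiberFunctor (𝒢.transportE he ⋙ F₂) := by
  subst he
  exact hF

/-! ### The loop transport element of `Π_𝒢` -/

section Loop

variable (b' : 𝒢.graph.Branch) (hb' : 𝒢.graph.edgeOf b' = 𝒢.graph.edgeOf b)
  (h' : 𝒢.graph.abuts b' = some v) (α' : (𝒢.pull b' v h').pullback ⋙ (𝒢.transportE hb' ⋙ Fe) ≅ F)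

omit [FiberFunctor F] [FiberFunctor Fe] in
/-- **The loop element `t ∈ Π_𝒢`.**  For two branches `b, b'` of one edge `e`, both abutting to `v`,
basepoints `F` of `𝒢_v`, `F_e` of `𝒢_e` and transports `α : b^* ⋙ F_e ≅ F`, `α' : b'^* ⋙ F_e ≅ F`,
there is an element `t` of `Π_𝒢 = Aut(ρ_v ⋙ F)` acting on the fibre `F(S_v)` of EVERY object
`Y ∈ B(𝒢)` by `x ↦ α'(F_e(ψ_{b'}⁻¹)(F_e(ψ_b)(α⁻¹ x)))` — the edge-path transport around the loop
(the two branches induce the same OUTER homomorphism `Π_b → Π_𝒢`, Def. 2.1 p. 23, the basepoint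
being determined "up to inner automorphism", p. 22). [cite: MochizukiSemiAnbd2006, Def. 2.1 p.23] -/
theorem exists_pi_loopTransport :
    ∃ t : 𝒢.Pi v F, ∀ (Y : 𝒢.BObj) (x : (𝒢.ρ v ⋙ F).obj Y),
      t • x = α'.hom.app (Y.S v) ((𝒢.transportE hb' ⋙ Fe).map (Y.ψ b' v h').inv
        (Fe.map (eqToHom (𝒢.transportE_obj_T Y hb').symm)
          (Fe.map (Y.ψ b v h).hom (α.inv.app (Y.S v) x)))) := by
  -- the comparison isomorphisms `m_Y : b^* Y_v ≅ transportE (b'^* Y_v)` in `𝒢_{e(b)}`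
  let m : ∀ Y : 𝒢.BObj,
      (𝒢.pull b v h).pullback.obj (Y.S v) ≅
        (𝒢.transportE hb').obj ((𝒢.pull b' v h').pullback.obj (Y.S v)) := fun Y =>
    Y.ψ b v h ≪≫ eqToIso (𝒢.transportE_obj_T Y hb').symm ≪≫
      ((𝒢.transportE hb').mapIso (Y.ψ b' v h')).symm
  -- naturality of `m` in `Y` (cf. abc-iut-L3-t12's `exists_edgePathIso`)
  have hm : ∀ {Y Z : 𝒢.BObj} (f : Y ⟶ Z),
      (𝒢.pull b v h).pullback.map (f.fS v) ≫ (m Z).hom =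
        (m Y).hom ≫ (𝒢.transportE hb').map ((𝒢.pull b' v h').pullback.map (f.fS v)) := by
    intro Y Z f
    have h1 : (𝒢.transportE hb').map ((𝒢.pull b' v h').pullback.map (f.fS v)) =
        (𝒢.transportE hb').map (Y.ψ b' v h').hom ≫
          (𝒢.transportE hb').map (f.fT (𝒢.graph.edgeOf b')) ≫
            (𝒢.transportE hb').map (Z.ψ b' v h').inv := by
      rw [← Functor.map_comp, ← Functor.map_comp]
      congr 1
      rw [← Category.assoc, ← f.comm b' v h', Category.assoc, Iso.hom_inv_id, Category.comp_id]
    have h2 := transportE_map_fT f hb'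
    simp only [m, Iso.trans_hom, Iso.symm_hom, Functor.mapIso_inv, eqToIso.hom, Category.assoc]
    rw [reassoc_of% (f.comm b v h), h1, h2]
    simp only [Category.assoc, ← Functor.map_comp_assoc, Iso.inv_hom_id]
    simp
  -- the transport of basepoints `ε : ρ_v ⋙ (b^* ⋙ F_e) ≅ ρ_v ⋙ (b'^* ⋙ F_e)`
  let ε : 𝒢.ρ v ⋙ ((𝒢.pull b v h).pullback ⋙ Fe) ≅
      𝒢.ρ v ⋙ ((𝒢.pull b' v h').pullback ⋙ (𝒢.transportE hb' ⋙ Fe)) :=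
    NatIso.ofComponents (fun Y => Fe.mapIso (m Y)) (fun {Y Z} f => by
      change Fe.map ((𝒢.pull b v h).pullback.map (f.fS v)) ≫ Fe.map (m Z).hom =
        Fe.map (m Y).hom ≫ Fe.map ((𝒢.transportE hb').map ((𝒢.pull b' v h').pullback.map (f.fS v)))
      rw [← Fe.map_comp, ← Fe.map_comp, hm])
  refine ⟨(Functor.isoWhiskerLeft (𝒢.ρ v) α).symm ≪≫ ε ≪≫ Functor.isoWhiskerLeft (𝒢.ρ v) α',
    fun Y x => ?_⟩
  rw [mulAction_def]
  simp only [Iso.trans_hom, NatTrans.comp_app, FintypeCat.comp_apply, Iso.symm_hom,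
    Functor.isoWhiskerLeft_inv, Functor.isoWhiskerLeft_hom, Functor.whiskerLeft_app]
  change α'.hom.app (Y.S v) (Fe.map (m Y).hom (α.inv.app (Y.S v) x)) = _
  simp only [m, Iso.trans_hom, Iso.symm_hom, Functor.mapIso_inv, eqToIso.hom, Fe.map_comp,
    FintypeCat.comp_apply]
  rfl

omit [FiberFunctor Fe] in
/-- **The `b'`-end of the level edge through `x` is the level vertex through `t · x`.**  If `Q ∋ y(x)`
is the level edge of `𝒢_X` through `x ∈ F(S_v)` (`b`-frame), `Q'` the same component of `T_e` read in
the `b'`-frame (`HEq Q' Q` along `e(b') = e(b)`), and `P` the level vertex through the transported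
point `α'(F_e(ψ_{b'}⁻¹)(y x))` (`= t · x` for the loop element `t`), then the component of `S_v` under
`Q'` along `b'` is `P`. [cite: MochizukiSemiAnbd2006, Def. 2.2(i) p.23] -/
theorem componentOver_eq_of_mem_transport {x : F.obj (X.S v)} {Q : π₀Obj (X.T (𝒢.graph.edgeOf b))}
    (hQ : Fe.map (X.ψ b v h).hom (α.inv.app (X.S v) x) ∈ Set.range (Fe.map Q.1.arrow))
    (Q' : π₀Obj (X.T (𝒢.graph.edgeOf b'))) (hQQ' : HEq Q' Q) {P : π₀Obj (X.S v)}
    (hP : α'.hom.app (X.S v) ((𝒢.transportE hb' ⋙ Fe).map (X.ψ b' v h').inv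
        (Fe.map (eqToHom (𝒢.transportE_obj_T X hb').symm)
          (Fe.map (X.ψ b v h).hom (α.inv.app (X.S v) x)))) ∈ Set.range (F.map P.1.arrow)) :
    X.componentOver b' v h' Q' = P := by
  refine componentOver_eq_of_mem X F b' h' (𝒢.transportE hb' ⋙ Fe) α' ?_ hP
  -- `α'⁻¹ ∘ α' = id` and `ψ_{b'} ∘ ψ_{b'}⁻¹ = id`
  have h1 : ∀ (S : 𝒢.V v) (w : ((𝒢.pull b' v h').pullback ⋙ (𝒢.transportE hb' ⋙ Fe)).obj S),
      α'.inv.app S (α'.hom.app S w) = w := fun S w => by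
    rw [← FintypeCat.comp_apply (α'.hom.app S) (α'.inv.app S), ← NatTrans.comp_app, α'.hom_inv_id,
      NatTrans.id_app, FintypeCat.id_apply]
  rw [h1, ← FintypeCat.comp_apply, ← (𝒢.transportE hb' ⋙ Fe).map_comp, Iso.inv_hom_id,
    (𝒢.transportE hb' ⋙ Fe).map_id, FintypeCat.id_apply]
  exact mem_range_transport X hb' Fe Q' Q hQQ' _ hQ

end Loop

/-! ### Level vertices through `x` and `t · x`: loops all or none -/

omit [FiberFunctor Fe] in
/-- **Loops all or none.**  If every point of the fibre of `X` has stabiliser `V ⊆ Π_𝒢` (e.g. the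
Galois object `A_V`), then for ANY `t ∈ Π_𝒢` and any point `x` with level vertices `P ∋ x`,
`P' ∋ t · x`: `P = P'` iff `t ∈ Π_v · V` — a condition independent of `x` (components of `S_v` ↔
`Π_v`-orbits of `F(S_v)`). [cite: MochizukiSemiAnbd2006, Rem. 2.2.1 p.24] -/
theorem vComp_eq_iff_mem_range_mul {V : Subgroup (𝒢.Pi v F)}
    (hV : ∀ x : (𝒢.ρ v ⋙ F).obj X, MulAction.stabilizer (𝒢.Pi v F) x = V) (t : 𝒢.Pi v F)
    {x : (𝒢.ρ v ⋙ F).obj X} {P P' : π₀Obj (X.S v)}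
    (hP : (show F.obj (X.S v) from x) ∈ Set.range (F.map P.1.arrow))
    (hP' : (show F.obj (X.S v) from t • x) ∈ Set.range (F.map P'.1.arrow)) :
    P = P' ↔ t ∈ ((𝒢.piVToPi v F).range : Set (𝒢.Pi v F)) * (V : Set (𝒢.Pi v F)) := by
  rw [component_eq_iff_range_eq F, range_map_arrow_eq_orbit F P hP,
    range_map_arrow_eq_orbit F P' hP', eq_comm, MulAction.orbit_eq_iff, MulAction.mem_orbit_iff,
    Set.mem_mul]
  constructor
  · rintro ⟨p, hp⟩
    refine ⟨𝒢.piVToPi v F p, ⟨p, rfl⟩, (𝒢.piVToPi v F p)⁻¹ * t, ?_, mul_inv_cancel_left _ _⟩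
    rw [SetLike.mem_coe, ← hV x, MulAction.mem_stabilizer_iff, mul_smul, inv_smul_eq_iff, piVToPi_smul]
    exact hp.symm
  · rintro ⟨_, ⟨p, rfl⟩, s, hs, rfl⟩
    refine ⟨p, ?_⟩
    rw [SetLike.mem_coe, ← hV x, MulAction.mem_stabilizer_iff] at hs
    rw [mul_smul, hs]
    exact (piVToPi_smul X F p x).symm

/-! ### The loop hypothesis of `exists_bObj_trivial_nontrivial` for two level edges over one edge -/

omit [FiberFunctor F] [FiberFunctor Fe] in
/-- A branch `(b'', c)` of `𝒢_X` over the level edge `(e(b), Q)`: `b''` is a branch of `e(b)` and `c` is the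
component `Q` read in the `b''`-frame. [cite: MochizukiSemiAnbd2006, Def. 2.2(i) p.23] -/
private theorem branch_over_edge_mk {Q : π₀Obj (X.T (𝒢.graph.edgeOf b))} (b'' : 𝒢.graph.Branch)
    (c : X.fibreData.FE (𝒢.graph.edgeOf b''))
    (hbc : X.coveringGraph.graph.edgeOf ⟨b'', c⟩ = ⟨𝒢.graph.edgeOf b, equivShrink _ Q⟩) :
    ∃ (_ : 𝒢.graph.edgeOf b'' = 𝒢.graph.edgeOf b) (Q'' : π₀Obj (X.T (𝒢.graph.edgeOf b''))),
      HEq Q'' Q ∧ c = equivShrink _ Q'' := by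
  have he : 𝒢.graph.edgeOf b'' = 𝒢.graph.edgeOf b := congrArg Sigma.fst hbc
  have hc : HEq c (equivShrink (π₀Obj (X.T (𝒢.graph.edgeOf b))) Q) := (Sigma.mk.inj_iff.mp hbc).2
  refine ⟨he, (equivShrink _).symm c, ?_, ((equivShrink _).apply_symm_apply c).symm⟩
  have key : ∀ (e₁ e₂ : 𝒢.graph.Edge) (_ : e₁ = e₂) (c₁ : Shrink.{u} (π₀Obj (X.T e₁)))
      (Q₂ : π₀Obj (X.T e₂)), HEq c₁ (equivShrink (π₀Obj (X.T e₂)) Q₂) →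
      HEq ((equivShrink (π₀Obj (X.T e₁))).symm c₁) Q₂ := by
    intro e₁ e₂ hee c₁ Q₂ hc₁
    subst hee
    cases hc₁
    exact heq_of_eq ((equivShrink _).symm_apply_apply Q₂)
  exact key _ _ he c Q hc

omit [FiberFunctor F] [FiberFunctor Fe] in
/-- The component `Q` of `T_{e(b)}` read in the frame of another branch `b''` of `e(b)`, and the level
edge it names (the same one). [cite: MochizukiSemiAnbd2006, Def. 2.2(i) p.23] -/
private theorem exists_comp_transport (b'' : 𝒢.graph.Branch) (hb'' : 𝒢.graph.edgeOf b'' = 𝒢.graph.edgeOf b)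
    (Q : π₀Obj (X.T (𝒢.graph.edgeOf b))) :
    ∃ Q'' : π₀Obj (X.T (𝒢.graph.edgeOf b'')), HEq Q'' Q ∧
      X.coveringGraph.graph.edgeOf ⟨b'', equivShrink _ Q''⟩ = ⟨𝒢.graph.edgeOf b, equivShrink _ Q⟩ := by
  have key : ∀ (e₁ e₂ : 𝒢.graph.Edge) (_ : e₁ = e₂) (Q₂ : π₀Obj (X.T e₂)),
      ∃ Q₁ : π₀Obj (X.T e₁), HEq Q₁ Q₂ ∧
        (⟨e₁, equivShrink _ Q₁⟩ : X.coveringGraph.graph.Edge) = ⟨e₂, equivShrink _ Q₂⟩ := by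
    intro e₁ e₂ hee Q₂
    subst hee
    exact ⟨Q₂, HEq.rfl, rfl⟩
  exact key _ _ hb'' Q

omit [FiberFunctor F] [FiberFunctor Fe] in
/-- Two level vertices `(v, P)`, `(v, P')` of `𝒢_X` are equal only if `P = P'`. [folklore] -/
private theorem vComp_eq_of_vertex_mk_eq {P P' : π₀Obj (X.S v)}
    (hPP' : (some ⟨v, equivShrink _ P⟩ : Option X.coveringGraph.graph.Vertex) =
      some ⟨v, equivShrink _ P'⟩) : P = P' :=
  (equivShrink _).injective (eq_of_heq (Sigma.mk.inj_iff.mp (Option.some_injective _ hPP')).2)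

/-- **Loops all or none, for the two ends of level edges.**  Let every point of the fibre of `X` have
stabiliser `V`, let `Q₁ ∋ y(x₁)`, `Q₂ ∋ y(x₂)` be the level edges through `x₁, x₂` with level vertices
`P₁ ∋ x₁`, `P₂ ∋ x₂` (their `b`-ends), and let `b''` be a branch of `e(b)` abutting to `v`.  If the
`b''`-end of `(e, Q₁)` is `(v, P₁)`, then the `b''`-end of `(e, Q₂)` is `(v, P₂)`.
[cite: MochizukiSemiAnbd2006, Rem. 2.10.1 p.32] -/
theorem componentOver_eq_of_componentOver_eq {V : Subgroup (𝒢.Pi v F)}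
    (hV : ∀ x : (𝒢.ρ v ⋙ F).obj X, MulAction.stabilizer (𝒢.Pi v F) x = V)
    {x₁ x₂ : F.obj (X.S v)} {Q₁ Q₂ : π₀Obj (X.T (𝒢.graph.edgeOf b))}
    (hQ₁ : Fe.map (X.ψ b v h).hom (α.inv.app (X.S v) x₁) ∈ Set.range (Fe.map Q₁.1.arrow))
    (hQ₂ : Fe.map (X.ψ b v h).hom (α.inv.app (X.S v) x₂) ∈ Set.range (Fe.map Q₂.1.arrow))
    {P₁ P₂ : π₀Obj (X.S v)} (hP₁ : x₁ ∈ Set.range (F.map P₁.1.arrow))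
    (hP₂ : x₂ ∈ Set.range (F.map P₂.1.arrow))
    (b'' : 𝒢.graph.Branch) (hb'' : 𝒢.graph.edgeOf b'' = 𝒢.graph.edgeOf b)
    (h'' : 𝒢.graph.abuts b'' = some v) (Q₁'' Q₂'' : π₀Obj (X.T (𝒢.graph.edgeOf b'')))
    (hQ₁'' : HEq Q₁'' Q₁) (hQ₂'' : HEq Q₂'' Q₂) (hend : X.componentOver b'' v h'' Q₁'' = P₁) :
    X.componentOver b'' v h'' Q₂'' = P₂ := by
  -- a vertex transport for the `b''`-frame and the loop element `t`
  haveI : FiberFunctor (𝒢.transportE hb'' ⋙ Fe) := fiberFunctor_transportE hb'' Fe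
  haveI : FiberFunctor ((𝒢.pull b'' v h'').pullback ⋙ (𝒢.transportE hb'' ⋙ Fe)) :=
    fiberFunctor_comp_of_exact _ _
  obtain ⟨α''⟩ := nonempty_iso_of_fiberFunctor
    ((𝒢.pull b'' v h'').pullback ⋙ (𝒢.transportE hb'' ⋙ Fe)) F
  obtain ⟨t, ht⟩ := exists_pi_loopTransport F b h Fe α b'' hb'' h'' α''
  -- the level vertices through `t · x₁`, `t · x₂` are the `b''`-ends
  obtain ⟨P₁', hP₁'⟩ :=
    exists_vComp_mem X F (show F.obj (X.S v) from t • (show (𝒢.ρ v ⋙ F).obj X from x₁))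
  obtain ⟨P₂', hP₂'⟩ :=
    exists_vComp_mem X F (show F.obj (X.S v) from t • (show (𝒢.ρ v ⋙ F).obj X from x₂))
  have hend₁ : X.componentOver b'' v h'' Q₁'' = P₁' :=
    componentOver_eq_of_mem_transport X F b h Fe α b'' hb'' h'' α'' hQ₁ Q₁'' hQ₁''
      (by rw [← ht]; exact hP₁')
  have hend₂ : X.componentOver b'' v h'' Q₂'' = P₂' :=
    componentOver_eq_of_mem_transport X F b h Fe α b'' hb'' h'' α'' hQ₂ Q₂'' hQ₂''
      (by rw [← ht]; exact hP₂')
  -- loops all or none: `P₁' = P₁` forces `t ∈ Π_v · V`, hence `P₂' = P₂`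
  have ht₁ := (vComp_eq_iff_mem_range_mul X F hV t hP₁ hP₁').mp (hend.symm.trans hend₁)
  rw [hend₂]
  exact ((vComp_eq_iff_mem_range_mul X F hV t hP₂ hP₂').mpr ht₁).symm

/-- **The loop hypothesis for two level edges over one edge.**  Let every point of the fibre of
`X ∈ B(𝒢)` have stabiliser `V` (abc-iut-L3-t12's Galois object `A_V`), and let `Q₁ ∋ y(x₁)`,
`Q₂ ∋ y(x₂)` be the level edges of `𝒢_X = X.coveringGraph` through two points `x₁, x₂ ∈ F(S_v)`
(`b`-frame).  Then, for every vertex `w̃` of `𝒢_X`: if BOTH branches of `(e, Q₁)` abut to `w̃` and SOME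
branch of `(e, Q₂)` abuts to `w̃`, then both branches of `(e, Q₂)` abut to `w̃` — literally the
hypothesis `hloop` of `IsOfSurfaceType.exists_bObj_trivial_nontrivial` for the branches `(b, Q₂)`,
`(b, Q₁)` of `𝒢_X` (loops over a loop `e` are all-or-none; vacuous when `e` is not a loop at `v`).
[cite: MochizukiSemiAnbd2006, Rem. 2.10.1 p.32] -/
theorem coveringGraph_hloop {V : Subgroup (𝒢.Pi v F)}
    (hV : ∀ x : (𝒢.ρ v ⋙ F).obj X, MulAction.stabilizer (𝒢.Pi v F) x = V)
    {x₁ x₂ : F.obj (X.S v)} {Q₁ Q₂ : π₀Obj (X.T (𝒢.graph.edgeOf b))}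
    (hQ₁ : Fe.map (X.ψ b v h).hom (α.inv.app (X.S v) x₁) ∈ Set.range (Fe.map Q₁.1.arrow))
    (hQ₂ : Fe.map (X.ψ b v h).hom (α.inv.app (X.S v) x₂) ∈ Set.range (Fe.map Q₂.1.arrow)) :
    ∀ wc : X.coveringGraph.graph.Vertex,
      (∀ bc : X.coveringGraph.graph.Branch,
        X.coveringGraph.graph.edgeOf bc = ⟨𝒢.graph.edgeOf b, equivShrink _ Q₁⟩ →
          X.coveringGraph.graph.abuts bc = some wc) →
      (∃ bc : X.coveringGraph.graph.Branch,
        X.coveringGraph.graph.edgeOf bc = ⟨𝒢.graph.edgeOf b, equivShrink _ Q₂⟩ ∧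
          X.coveringGraph.graph.abuts bc = some wc) →
      ∀ bc : X.coveringGraph.graph.Branch,
        X.coveringGraph.graph.edgeOf bc = ⟨𝒢.graph.edgeOf b, equivShrink _ Q₂⟩ →
          X.coveringGraph.graph.abuts bc = some wc := by
  intro wc hall hex bc hbc
  -- the level vertices through `x₁`, `x₂` (the `b`-ends of the two level edges)
  obtain ⟨P₁, hP₁⟩ := exists_vComp_mem X F x₁
  obtain ⟨P₂, hP₂⟩ := exists_vComp_mem X F x₂
  have hab₁ : X.coveringGraph.graph.abuts ⟨b, equivShrink _ Q₁⟩ = some ⟨v, equivShrink _ P₁⟩ := by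
    rw [coveringGraph_abuts_mk X b h, componentOver_eq_of_mem X F b h Fe α hQ₁ hP₁]
  -- hence `w̃ = (v, P₁)`
  have hwc : wc = ⟨v, equivShrink _ P₁⟩ :=
    Option.some_injective _ ((hall ⟨b, equivShrink _ Q₁⟩ rfl).symm.trans hab₁)
  subst hwc
  -- every branch `(b'', Q₂'')` over `(e, Q₂)` abuts to `(v, P₂)`
  have hend : ∀ (b'' : 𝒢.graph.Branch) (c : X.fibreData.FE (𝒢.graph.edgeOf b'')),
      X.coveringGraph.graph.edgeOf ⟨b'', c⟩ = ⟨𝒢.graph.edgeOf b, equivShrink _ Q₂⟩ →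
      X.coveringGraph.graph.abuts ⟨b'', c⟩ = some ⟨v, equivShrink _ P₂⟩ := by
    intro b'' c hbc''
    obtain ⟨hb'', Q₂'', hQ₂'', rfl⟩ := branch_over_edge_mk X b b'' c hbc''
    -- the `b''`-branch of `(e, Q₁)` abuts to `(v, P₁)` by `hall`; so `b''` abuts to `v`
    obtain ⟨Q₁'', hQ₁'', hedge₁⟩ := exists_comp_transport X b b'' hb'' Q₁
    have h1 := hall ⟨b'', equivShrink _ Q₁''⟩ hedge₁
    have h'' : 𝒢.graph.abuts b'' = some v := BObj.abuts_fst h1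
    rw [coveringGraph_abuts_mk X b'' h''] at h1 ⊢
    rw [componentOver_eq_of_componentOver_eq X F b h Fe α hV hQ₁ hQ₂ hP₁ hP₂ b'' hb'' h'' Q₁'' Q₂''
      hQ₁'' hQ₂'' (vComp_eq_of_vertex_mk_eq X h1)]
  -- in particular the witness of `hex` does, so `P₂ = P₁`; and so does `bc`
  obtain ⟨⟨b₃, c₃⟩, hbc₃, hab₃⟩ := hex
  have hP₂P₁ : P₂ = P₁ := vComp_eq_of_vertex_mk_eq X ((hend b₃ c₃ hbc₃).symm.trans hab₃)
  obtain ⟨b'', c''⟩ := bc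
  rw [hend b'' c'' hbc, hP₂P₁]

end SemiGraphOfAnabelioids

end Literature.AnabelianGeometry.SemiGraphs
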